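import Summits.NavierStokesRegularity.FunctionalMining.PalinstrophyLogDoorThreshold
import Summits.NavierStokesRegularity.FunctionalMining.NoGo.PalinstrophyLogThreshold
import HarnessLib

/-!
# Functional mining — the WINDOW of the log door K1-Q3(a): unconditional threshold facts and the typed
window conjecture (no-go seat, gen 5; STAGED for the prove seat)

Search for candidate a priori estimates; no regularity claim.

Cell `pub-nsfunc` (host summit NavierStokesRegularity, topic `FunctionalMining`), NO-GO branch, gen 5.
Planner seats do not file under `FunctionalMining/`; intended home `NoGo/PalinstrophyLogWindow.lean`.
Paper companion: `pub-nsfunc-nogo/WINDOW.md` (UNREVIEWED; method-class ceilings, not used here).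

WHAT IS IN THE TREE (imports): the threshold object `logBudgetThreshold c = sInf {C | PalinstrophyLogBudget C c}`
=: `C₀(c)` with its order bookkeeping (`PalinstrophyLogDoorThreshold.lean`, dict/prove) and the
conjecture-tagged statement `PalinstrophyLogThreshold` (= NO-GO #4: the door fails for every
`c > 0`, `C < 2/π`; paper proof `pub-nsfunc-nogo/THRESHOLD.md`).

WHAT THIS FILE ADDS (bookkeeping only — no analysis; the UNCONDITIONAL threshold facts — `0 ≤ C₀(c)`,
`1/40 ≤ C₀(c)` on `(0,1]`, antitone, valid set `= [C₀(c), ∞)`, `C₀(c) ≤ C₀(c')(1 + log(c'/c))` — are the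
dictionary's staged `LogDoorVerdict.lean` (v9) and are NOT duplicated here; no name clashes with it):
* CONDITIONAL ON NO-GO #4 (`PalinstrophyLogThreshold`, to be proved): `2/π ≤ C₀(c)` for every `c > 0`
  (`PalinstrophyLogThreshold.two_div_pi_le_threshold`; the dictionary's general form is
  `le_logBudgetThreshold_of_failsBelow`).
* THE WINDOW CONJECTURE, typed: `PalinstrophyLogWindowUpper` (W⁺: every `C > 2/π` is valid at SOME
  log-scale `c > 0`) — conjecture-tagged, nothing asserted; together with NO-GO #4 it pins the infimum
  of the threshold function: `⨅_{c>0} C₀(c) = 2/π` (`iInf_logBudgetThreshold_fin3`, proved from the two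
  hypotheses). `pub-nsfunc-nogo/WINDOW.md` records why every known witness architecture stops at `2/π`
  (passive packets) and why no "log-strain × fine-structure" witness can pass `1.103`; W⁺ is the
  falsifiable half of the conjecture that the true asymptotic threshold is `2/π`.
Nothing here is a statement about Navier–Stokes regularity: `PalinstrophyLogBudget C c` is ONE candidate
a priori inequality and `C₀(c)` its best constant.
-/

noncomputable section

open Set

namespace Summit.NavierStokesRegularity.FunctionalMining

variable {d : Type*} [Fintype d] [DecidableEq d]

/-- **Window conjecture W⁺ (no-go seat gen 5, `WINDOW.md` §4; OPEN, nothing asserted):** every constant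
`C > 2/π` is a valid log-door constant at some log-scale `c > 0`. With NO-GO #4 (`PalinstrophyLogThreshold`:
nothing below `2/π` is valid at any `c > 0`) it says the threshold function `C₀(c)` decreases to exactly
`2/π`. Evidence and the method-class analysis: `WINDOW.md`. Meaningful at `Fintype.card d = 3`.
Search for candidate a priori estimates; no regularity claim. -/
@[conjecture] def PalinstrophyLogWindowUpper : Prop :=
  ∀ C : ℝ, 2 / Real.pi < C → ∃ c : ℝ, 0 < c ∧ PalinstrophyLogBudget (d := d) C c

/-! ## Conditional on NO-GO #4: the lower edge of the window -/

/-- NO-GO #4 ⇒ `2/π ≤ C₀(c)` for every `c > 0`. [ours] -/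
theorem PalinstrophyLogThreshold.two_div_pi_le_threshold (hW : PalinstrophyLogThreshold (d := Fin 3))
    {c : ℝ} (hc : 0 < c) : 2 / Real.pi ≤ logBudgetThreshold (d := Fin 3) c := by
  by_contra h
  rw [not_le] at h
  have hC : (logBudgetThreshold (d := Fin 3) c + 2 / Real.pi) / 2 < 2 / Real.pi := by linarith
  have hle := le_logBudgetThreshold_fin3 hc (hW c hc _ hC)
  linarith

/-! ## The window, typed: NO-GO #4 ∧ W⁺ pin the infimum of the threshold function -/

/-- NO-GO #4 and the window conjecture W⁺ together give `⨅_{c > 0} C₀(c) = 2/π` at `d = Fin 3`: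
the lower bound for every `c` is NO-GO #4, and W⁺ supplies, for every `ε > 0`, a log-scale at which
`2/π + ε/2` is valid. [ours] -/
theorem iInf_logBudgetThreshold_fin3 (hW : PalinstrophyLogThreshold (d := Fin 3))
    (hW' : PalinstrophyLogWindowUpper (d := Fin 3)) :
    ⨅ c : Set.Ioi (0 : ℝ), logBudgetThreshold (d := Fin 3) (c : ℝ) = 2 / Real.pi := by
  haveI : Nonempty (Set.Ioi (0 : ℝ)) := ⟨⟨1, Set.mem_Ioi.mpr one_pos⟩⟩
  have hbdd : BddBelow (Set.range fun c : Set.Ioi (0 : ℝ) => logBudgetThreshold (d := Fin 3) (c : ℝ)) := by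
    refine ⟨2 / Real.pi, ?_⟩
    rintro _ ⟨c, rfl⟩
    exact hW.two_div_pi_le_threshold c.2
  refine le_antisymm ?_ (le_ciInf fun c => hW.two_div_pi_le_threshold c.2)
  refine le_of_forall_pos_lt_add fun ε hε => ?_
  obtain ⟨c, hc, hPLB⟩ := hW' (2 / Real.pi + ε / 2) (by linarith)
  have h1 : logBudgetThreshold (d := Fin 3) c ≤ 2 / Real.pi + ε / 2 :=
    logBudgetThreshold_le_fin3 hc (hW c hc 0 (by positivity)) hPLB
  calc ⨅ c' : Set.Ioi (0 : ℝ), logBudgetThreshold (d := Fin 3) (c' : ℝ)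
      ≤ logBudgetThreshold (d := Fin 3) c := ciInf_le hbdd ⟨c, hc⟩
    _ < 2 / Real.pi + ε := by linarith

end Summit.NavierStokesRegularity.FunctionalMining

end
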